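import Summits.ResolutionOfSingularities.ResolutionOfSingularities.Theorems.FrobeniusClosingPatchingRelPerfectDepthMixedFormatB
import Summits.ResolutionOfSingularities.ResolutionOfSingularities.Theorems.FrobeniusClosingPatchingRelPerfectDepthWeightedStepBookkeeping
import Literature.AlgebraicGeometry.Resolution.BoundaryRestriction
import Literature.AlgebraicGeometry.Resolution.MonomialMarkedIdealsBlowupGeneral
import HarnessLib

/-!
# Chain W5.2 — F5J X-side: TRACE BOOKKEEPING for the boundary-carrying format `MixedFormatB`

[OURS · L1 W5.2 · res-D-pv-052 AS stub-7, X-side owner of the format `P`; helper file for `StepMixedJR ℓ MixedFormatB`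
(res-L1-w52-plan-1's TargetsF5J v5.1 = `…DepthMixedTargetsJR`, p515168).] NOT a statement of the manuscript under review;
fact-free.

Setting: a closed immersion `i : E ⟶ X` (the exceptional hypersurface of the depth-`ℓ` invariant), an X-side boundary
`𝒢 : List (X.IdealSheafData × ℕ)` ALIGNED with the E-side boundary `ℬ` through the traces WITH THE SAME EXPONENTS
(`𝒢.map (·|_E, id) = ℬ`, the alignment clause of `DepthGraded.MixedFormatB`, p514436), and a centre `C` on `E` pushed to
`Ĉ = C.map i` on `X`.  Everything the E-side `IsWeightedSeqJR.cons` step asserts about `(ℬ, C)` is READ ON `X` for `(𝒢, Ĉ)`: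

* `stalkIdeal_le_map_centre_iff` — incidence with the pushed centre is incidence of the trace: `G_{i z} ≤ Ĉ_{i z} ↔
  (G|_E)_z ≤ C_z` (`𝓘_E ≤ Ĉ`, `Ĉ|_E = C`);
* `uniformPieces_map_of_traces` — `UniformPieces ℬ C [V(C)] → UniformPieces 𝒢 Ĉ [V(Ĉ)]`;
* `weightOf_divisorsOver_map_eq` — the weights agree: `weightOf 𝒢 (divisorsOver 𝒢 Ĉ V(Ĉ)) = weightOf ℬ (divisorsOver ℬ C V(C))`
  (so the exponents `m + w − ν`, `w_𝒟 + (ℓ − ν)` booked by `IsWeightedSeqJR.cons` are the X-side ones);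
* `boundaryRel_of_traces` / **`hasSNCWith_cons_map_of_traces`** — `HasSNC (𝓘_E :: 𝒢)` on `X` + aligned traces +
  `HasSNCWith ℬ C` on `E` ⇒ `HasSNCWith (𝓘_E :: 𝒢) Ĉ` (Kollár 3.85 «the role played by `E`», the tree's `BoundaryRel.hasSNCWith_map`);
* **`comap_strictTransformIdeal_of_traces`** — along the dictionary square `i' ≫ σ = τ ≫ i` (`σ` a blow-up along `Ĉ`, `τ`
  along `C`) the strict transform of a boundary member RESTRICTS to the strict transform of its trace:
  `(strictTransformIdeal σ Ĉ G)|_{E'} = strictTransformIdeal τ C (G|_E)` — both sides solve `B𝒪_{E'} = (C𝒪_{E'})^ε · (?)`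
  with the SAME `ε ∈ {0, 1}` (single-piece pieces calculus on `X` restricted, resp. on `E`), and the effective Cartier factor
  cancels; no saturation argument on `E'` is needed;
* list bookkeeping for the charged members and the transformed lists (`boundaryOf_map_strict`, `charged_map_comap`, …).

## References
* J. Kollár, *Lectures on Resolution of Singularities* (2007), Cor. 3.85 (proof), (3.111) Steps 1–3, Def. 3.25. [Kollar2007]
* E. Bierstone, D. Grigoriev, P. Milman, J. Włodarczyk, arXiv:1206.3090, Def. 3.1.3 (2), (4), §3.2 Lemma 3.2.1, §4 Step 2a,
  Lemma 3.9.4 (3). [BierstoneGrigorievMilmanWlodarczyk2011]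
-/

-- `Summit.<Summit>.<Sub>.Theorems` with `Sub = Summit` (single-conjunct summit, D-0017)
set_option linter.dupNamespace false

noncomputable section

open CategoryTheory CategoryTheory.Limits AlgebraicGeometry TopologicalSpace IsLocalRing
open Literature.AlgebraicGeometry.Resolution
open Scheme.IdealSheafData

namespace Summit.ResolutionOfSingularities.ResolutionOfSingularities.Theorems

universe u

namespace DepthGraded

namespace Trace

variable {E X : Scheme.{u}} (i : E ⟶ X) [IsClosedImmersion i]

/-! ## §1 Incidence with the pushed centre is read on `E` -/

omit [IsClosedImmersion i] in
/-- Points of `V(G|_E)` are the points of `E` mapping to `V(G)`. [folklore] -/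
theorem mem_support_comap_iff (G : X.IdealSheafData) (z : E) : z ∈ (G.comap i).support ↔ i.base z ∈ G.support := by
  rw [Scheme.IdealSheafData.support_comap]; rfl

/-- Points of the pushed centre `V(C.map i)` are the images of the points of `V(C)`. [folklore] -/
theorem exists_eq_of_mem_support_map {C : E.IdealSheafData} {x : X} (hx : x ∈ ((C.map i).support : Set X)) :
    ∃ z : E, z ∈ (C.support : Set E) ∧ i.base z = x := by
  rw [coe_support_map_of_isClosedImmersion] at hx
  exact hx

/-- The image of a point of `V(C)` lies on `V(C.map i)`. [folklore] -/
theorem apply_mem_support_map {C : E.IdealSheafData} {z : E} (hz : z ∈ (C.support : Set E)) :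
    i.base z ∈ ((C.map i).support : Set X) := by
  rw [coe_support_map_of_isClosedImmersion]
  exact ⟨z, hz, rfl⟩

/-- **Incidence with the pushed centre is incidence of the trace**: for ANY ideal sheaf `G` on `X`, a centre `C` on `E`
and `z : E`, `G_{i z} ≤ (C.map i)_{i z} ↔ (G|_E)_z ≤ C_z` (the stalk map of the closed immersion is surjective with kernel
`(𝓘_E)_{i z} ≤ (C.map i)_{i z}`, and `(C.map i)|_E = C`). [cite: Kollar2007, Cor. 3.85] -/
theorem stalkIdeal_le_map_centre_iff (G : X.IdealSheafData) (C : E.IdealSheafData) (z : E) :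
    stalkIdeal G (i.base z) ≤ stalkIdeal (C.map i) (i.base z) ↔ stalkIdeal (G.comap i) z ≤ stalkIdeal C z := by
  set q := (i.stalkMap z).hom with hqdef
  have hq : Function.Surjective q := i.stalkMap_surjective z
  have hkerq : RingHom.ker q = stalkIdeal i.ker (i.base z) := by
    rw [hqdef, ker_stalkMap_of_isClosedImmersion i z]
  have hC : stalkIdeal C z = (stalkIdeal (C.map i) (i.base z)).map q := by
    rw [hqdef, ← stalkIdeal_comap_eq_map_stalkMap, DepthOne.comap_map_centre]
  rw [stalkIdeal_comap_eq_map_stalkMap, ← hqdef, hC]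
  constructor
  · exact fun h => Ideal.map_mono h
  · intro h
    have h1 := Ideal.comap_mono (f := q) h
    rw [Ideal.comap_map_of_surjective q hq, Ideal.comap_map_of_surjective q hq, ← RingHom.ker_eq_comap_bot,
      hkerq] at h1
    have hker : stalkIdeal i.ker (i.base z) ≤ stalkIdeal (C.map i) (i.base z) :=
      stalkIdeal_mono (DepthOne.ker_le_map_centre i C) _
    exact le_sup_left.trans (h1.trans (sup_le le_rfl hker))

/-- The set form: `G` contains the pushed centre at all points of `V(C.map i)` iff `G|_E` contains `C` at all points of
`V(C)`. [folklore] -/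
theorem forall_stalkIdeal_le_map_centre_iff (G : X.IdealSheafData) (C : E.IdealSheafData) :
    (∀ x ∈ ((C.map i).support : Set X), stalkIdeal G x ≤ stalkIdeal (C.map i) x) ↔
      ∀ z ∈ (C.support : Set E), stalkIdeal (G.comap i) z ≤ stalkIdeal C z := by
  constructor
  · intro h z hz
    exact (stalkIdeal_le_map_centre_iff i G C z).mp (h _ (apply_mem_support_map i hz))
  · intro h x hx
    obtain ⟨z, hz, rfl⟩ := exists_eq_of_mem_support_map i hx
    exact (stalkIdeal_le_map_centre_iff i G C z).mpr (h z hz)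

/-! ## §2 Uniform incidence and weights transfer along the traces -/

variable {𝒢 : List (X.IdealSheafData × ℕ)} {ℬ : List (E.IdealSheafData × ℕ)}

omit [IsClosedImmersion i] in
/-- The trace of a member of the X-side boundary is a member of the E-side boundary. [folklore] -/
theorem comap_mem_boundaryOf (h𝒢 : 𝒢.map (fun p => (p.1.comap i, p.2)) = ℬ) {G : X.IdealSheafData}
    (hG : G ∈ boundaryOf 𝒢) : G.comap i ∈ boundaryOf ℬ := by
  rw [← MixedFormatB.map_comap_boundaryOf h𝒢]
  exact List.mem_map.mpr ⟨G, hG, rfl⟩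

omit [IsClosedImmersion i] in
/-- Every member of the E-side boundary is the trace of a member of the X-side boundary. [folklore] -/
theorem exists_eq_comap_of_mem_boundaryOf (h𝒢 : 𝒢.map (fun p => (p.1.comap i, p.2)) = ℬ) {B : E.IdealSheafData}
    (hB : B ∈ boundaryOf ℬ) : ∃ G ∈ boundaryOf 𝒢, G.comap i = B := by
  rw [← MixedFormatB.map_comap_boundaryOf h𝒢] at hB
  obtain ⟨G, hG, rfl⟩ := List.mem_map.mp hB
  exact ⟨G, hG, rfl⟩

/-- **Uniform incidence transfers to the X-side**: `UniformPieces ℬ C [V(C)] → UniformPieces 𝒢 (C.map i) [V(C.map i)]`.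
[cite: BierstoneGrigorievMilmanWlodarczyk2011, §4 Step 2a] -/
theorem uniformPieces_map_of_traces (h𝒢 : 𝒢.map (fun p => (p.1.comap i, p.2)) = ℬ) {C : E.IdealSheafData}
    (hU : UniformPieces ℬ C [C.support]) : UniformPieces 𝒢 (C.map i) [(C.map i).support] := by
  intro Z hZ G hG
  rw [List.mem_singleton] at hZ
  subst hZ
  rcases hU C.support (List.mem_singleton_self _) (G.comap i) (comap_mem_boundaryOf i h𝒢 hG) with h | h
  · exact Or.inl ((forall_stalkIdeal_le_map_centre_iff i G C).mpr h)
  · refine Or.inr fun x hx hxG hle => ?_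
    obtain ⟨z, hz, rfl⟩ := exists_eq_of_mem_support_map i hx
    exact h z hz ((mem_support_comap_iff i G z).mpr hxG) ((stalkIdeal_le_map_centre_iff i G C z).mp hle)

/-- **Membership in `divisorsOver` transfers**: for `p ∈ 𝒢`, `p.1 ∈ divisorsOver 𝒢 (C.map i) V(C.map i) ↔
p.1|_E ∈ divisorsOver ℬ C V(C)`. [cite: Kollar2007, (3.111) Step 1] -/
theorem mem_divisorsOver_map_iff (h𝒢 : 𝒢.map (fun p => (p.1.comap i, p.2)) = ℬ) (C : E.IdealSheafData)
    {p : X.IdealSheafData × ℕ} (hp : p ∈ 𝒢) :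
    p.1 ∈ divisorsOver 𝒢 (C.map i) (C.map i).support ↔ p.1.comap i ∈ divisorsOver ℬ C C.support := by
  have hpℬ : (p.1.comap i, p.2) ∈ ℬ := by rw [← h𝒢]; exact List.mem_map.mpr ⟨p, hp, rfl⟩
  rw [mem_divisorsOver_iff, mem_divisorsOver_iff, forall_stalkIdeal_le_map_centre_iff i p.1 C]
  exact ⟨fun h => ⟨fst_mem_boundaryOf hpℬ, h.2⟩, fun h => ⟨fst_mem_boundaryOf hp, h.2⟩⟩

/-- **The weights agree**: `weightOf 𝒢 (divisorsOver 𝒢 (C.map i) V(C.map i)) = weightOf ℬ (divisorsOver ℬ C V(C))` — the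
total exponent of the members containing the centre is read on either side.
[cite: BierstoneGrigorievMilmanWlodarczyk2011, §3.2 Lemma 3.2.1, §4 Step 2a] [cite: Kollar2007, (3.111) Step 1] -/
theorem weightOf_divisorsOver_map_eq (h𝒢 : 𝒢.map (fun p => (p.1.comap i, p.2)) = ℬ) (C : E.IdealSheafData) :
    weightOf 𝒢 (divisorsOver 𝒢 (C.map i) (C.map i).support) = weightOf ℬ (divisorsOver ℬ C C.support) := by
  classical
  -- by induction on the sub-lists of `𝒢`
  suffices h : ∀ 𝒢₀ : List (X.IdealSheafData × ℕ), (∀ p ∈ 𝒢₀, p ∈ 𝒢) →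
      weightOf 𝒢₀ (divisorsOver 𝒢 (C.map i) (C.map i).support) =
        weightOf (𝒢₀.map fun p => (p.1.comap i, p.2)) (divisorsOver ℬ C C.support) by
    have h1 := h 𝒢 fun _ hp => hp
    rwa [h𝒢] at h1
  intro 𝒢₀ h𝒢₀
  induction 𝒢₀ with
  | nil => rw [List.map_nil, weightOf_nil, weightOf_nil]
  | cons p 𝒢₀ ih =>
    rw [List.map_cons, weightOf_cons, weightOf_cons, ih fun q hq => h𝒢₀ q (List.mem_cons_of_mem _ hq)]
    have hiff := mem_divisorsOver_map_iff i h𝒢 C (h𝒢₀ p List.mem_cons_self)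
    by_cases hpT : p.1 ∈ divisorsOver 𝒢 (C.map i) (C.map i).support
    · rw [if_pos hpT, if_pos (hiff.mp hpT)]
    · rw [if_neg hpT, if_neg (fun h => hpT (hiff.mpr h))]

/-! ## §3 Simple normal crossings with the pushed centre, from the traces (Kollár 3.85) -/

/-- **The X-side boundary and its traces are related along `i`** (the tree's `BoundaryRel`): `HasSNC (𝓘_E :: 𝒢)` on `X`,
the trace list `𝒢.map (·|_E) = ℬ`, and `HasSNC ℬ` on `E` (members of a simple-normal-crossings family have non-zero
order-one stalks, so no member of `𝒢` through a point of `i(E)` is `V(𝓘_E)` there). [cite: Kollar2007, Cor. 3.85] -/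
theorem boundaryRel_of_traces {𝒢 : List X.IdealSheafData} {ℬ : List E.IdealSheafData}
    (hal : 𝒢.map (fun G => G.comap i) = ℬ) (hsnc : HasSNC (i.ker :: 𝒢)) (hℬ : HasSNC ℬ) : BoundaryRel i 𝒢 ℬ := by
  refine ⟨hsnc, ?_, ?_, fun z => hℬ.injOn_stalkIdeal z⟩
  · intro G hG z hx _
    refine ⟨G.comap i, by rw [← hal]; exact List.mem_map.mpr ⟨G, hG, rfl⟩, (mem_support_comap_iff i G z).mpr hx, rfl⟩
  · intro B hB z hz
    have hB' : B ∈ 𝒢.map (fun G => G.comap i) := by rw [hal]; exact hB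
    obtain ⟨G, hG, rfl⟩ := List.mem_map.mp hB'
    refine ⟨G, hG, (mem_support_comap_iff i G z).mp hz, ?_, rfl⟩
    intro heq
    -- then `(G|_E)_z = 0`, but it is generated by a member of a regular system of parameters
    obtain ⟨f, -, hf2, hf⟩ := hℬ.exists_generator_of_mem hB hz
    have hbot : stalkIdeal (G.comap i) z = ⊥ := by
      rw [stalkIdeal_comap_eq_map_stalkMap, heq, ← ker_stalkMap_of_isClosedImmersion i z, Ideal.map_eq_bot_iff_le_ker]
    rw [hf, Ideal.span_singleton_eq_bot] at hbot
    exact hf2 (by rw [hbot]; exact Ideal.zero_mem _)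

/-- **`HasSNCWith (𝓘_E :: 𝒢) (C.map i)` from the traces**: the X-side boundary together with the exceptional hypersurface
has simple normal crossings with the pushed centre, as soon as the traces have simple normal crossings with the centre on
`E` (Kollár 3.85: lift the adapted regular system of parameters of `𝒪_{E,z} = 𝒪_{X,iz}/(t)` choosing the equations of the
members of `𝒢` as lifts, and add `t`; the tree's `BoundaryRel.hasSNCWith_map`). [cite: Kollar2007, Cor. 3.85]
[cite: BierstoneGrigorievMilmanWlodarczyk2011, Lemma 3.9.4 (3)] -/
theorem hasSNCWith_cons_map_of_traces {𝒢 : List X.IdealSheafData} {ℬ : List E.IdealSheafData}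
    (hal : 𝒢.map (fun G => G.comap i) = ℬ) (hsnc : HasSNC (i.ker :: 𝒢)) {C : E.IdealSheafData}
    (hℬC : HasSNCWith ℬ C) : HasSNCWith (i.ker :: 𝒢) (C.map i) :=
  (boundaryRel_of_traces i hal hsnc hℬC.hasSNC).hasSNCWith_map i hℬC

/-- The same for exponent lists: `HasSNC (𝓘_E :: boundaryOf 𝒢)`, `𝒢.map (·|_E, id) = ℬ`, `HasSNCWith (boundaryOf ℬ) C` ⇒
`HasSNCWith (𝓘_E :: boundaryOf 𝒢) (C.map i)`. [cite: Kollar2007, Cor. 3.85] -/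
theorem hasSNCWith_cons_boundaryOf_map (h𝒢 : 𝒢.map (fun p => (p.1.comap i, p.2)) = ℬ)
    (hsnc : HasSNC (i.ker :: boundaryOf 𝒢)) {C : E.IdealSheafData} (hℬC : HasSNCWith (boundaryOf ℬ) C) :
    HasSNCWith (i.ker :: boundaryOf 𝒢) (C.map i) :=
  hasSNCWith_cons_map_of_traces i (MixedFormatB.map_comap_boundaryOf h𝒢) hsnc hℬC

/-- Dropping the hypersurface: `HasSNCWith (boundaryOf 𝒢) (C.map i)`. [folklore] -/
theorem hasSNCWith_boundaryOf_map (h𝒢 : 𝒢.map (fun p => (p.1.comap i, p.2)) = ℬ)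
    (hsnc : HasSNC (i.ker :: boundaryOf 𝒢)) {C : E.IdealSheafData} (hℬC : HasSNCWith (boundaryOf ℬ) C) :
    HasSNCWith (boundaryOf 𝒢) (C.map i) :=
  DepthSNC.hasSNCWith_of_forall_sncWithAt fun x =>
    ((hasSNCWith_cons_boundaryOf_map i h𝒢 hsnc hℬC).sncWithAt x).anti fun _ hD _ => List.mem_cons_of_mem _ hD

/-- Sub-families keep simple normal crossings with the centre (membership only). [folklore] -/
theorem hasSNCWith_of_subset {Es Es' : List X.IdealSheafData} {C : X.IdealSheafData} (h : HasSNCWith Es C)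
    (hsub : ∀ D ∈ Es', D ∈ Es) : HasSNCWith Es' C :=
  DepthSNC.hasSNCWith_of_forall_sncWithAt fun x => (h.sncWithAt x).anti fun D hD _ => hsub D hD

/-- `UniformPieces` for a sub-family (membership only). [folklore] -/
theorem uniformPieces_of_subset {X : Scheme.{u}} {𝒢 𝒩 : List (X.IdealSheafData × ℕ)} {C : X.IdealSheafData}
    {Zs : List (Closeds X)} (hU : UniformPieces 𝒢 C Zs) (hsub : ∀ G ∈ boundaryOf 𝒩, G ∈ boundaryOf 𝒢) :
    UniformPieces 𝒩 C Zs :=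
  fun Z hZ K hK => hU Z hZ K (hsub K hK)

/-! ## §4 The strict transform of a boundary member restricts to the strict transform of its trace -/

/-- **One boundary member under the blow-up** (single-piece pieces calculus for the list `[(G, 1)]`):
`G𝒪_{X'} = (Ĉ𝒪_{X'})^ε · strictTransformIdeal σ Ĉ G` with `ε = weightOf [(G,1)] (divisorsOver [(G,1)] Ĉ V(Ĉ)) ∈ {0, 1}`
(`1` iff `G` contains the centre). [cite: Kollar2007, (3.111) Step 1] [cite: BierstoneGrigorievMilmanWlodarczyk2011, §4 Step 2a] -/
theorem comap_eq_pow_mul_strictTransformIdeal {X : Scheme.{u}} [IsLocallyNoetherian X] {Es : List X.IdealSheafData}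
    {C : X.IdealSheafData} (hsnc : HasSNCWith Es C) {𝒢 : List (X.IdealSheafData × ℕ)} (hU : UniformPieces 𝒢 C [C.support])
    (hEs : ∀ G ∈ boundaryOf 𝒢, G ∈ Es) {X' : Scheme.{u}} {σ : X' ⟶ X} (hσ : IsBlowup σ C) {G : X.IdealSheafData}
    (hG : G ∈ boundaryOf 𝒢) :
    G.comap σ = C.comap σ ^ weightOf [(G, 1)] (divisorsOver [(G, 1)] C C.support) * strictTransformIdeal σ C G := by
  have hb : boundaryOf [(G, 1)] = [G] := rfl
  have hsnc1 : HasSNCWith (boundaryOf [(G, 1)]) C :=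
    hasSNCWith_of_subset hsnc fun D hD => by
      rw [hb, List.mem_singleton] at hD; rw [hD]; exact hEs G hG
  have hU1 : UniformPieces [(G, 1)] C [C.support] :=
    uniformPieces_of_subset hU fun D hD => by rw [hb, List.mem_singleton] at hD; rw [hD]; exact hG
  have h := DepthTargets.comap_monomialIdeal_support hsnc1 hσ hU1
  rwa [monomialIdeal_singleton, List.map_singleton, monomialIdeal_singleton, pow_one, pow_one] at h

/-- **The strict transform of a boundary member RESTRICTS to the strict transform of its trace** along the dictionary
square `i' ≫ σ = τ ≫ i` (`σ` a blow-up of `X` along `C.map i`, `τ` a blow-up of `E` along `C`): for `G ∈ boundaryOf 𝒢`,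
`(strictTransformIdeal σ (C.map i) G)|_{E'} = strictTransformIdeal τ C (G|_E)`.  Both `G𝒪 = (Ĉ𝒪)^ε · G'` on `X`
(restricted along `i'`) and `B𝒪 = (C𝒪)^ε · B'` on `E` hold with the SAME `ε` (`weightOf_divisorsOver_map_eq`), and the
effective Cartier factor `(C𝒪_{E'})^ε` cancels. [cite: Kollar2007, Cor. 3.85 (proof), (3.111) Step 1]
[cite: BierstoneGrigorievMilmanWlodarczyk2011, Def. 3.1.3 (4)] -/
theorem comap_strictTransformIdeal_of_traces [IsLocallyNoetherian X] [IsLocallyNoetherian E]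
    (h𝒢 : 𝒢.map (fun p => (p.1.comap i, p.2)) = ℬ) {C : E.IdealSheafData}
    (hsncX : HasSNCWith (boundaryOf 𝒢) (C.map i)) (hsncE : HasSNCWith (boundaryOf ℬ) C)
    (hUE : UniformPieces ℬ C [C.support])
    {X' E' : Scheme.{u}} {σ : X' ⟶ X} {τ : E' ⟶ E} (hσ : IsBlowup σ (C.map i)) (hτ : IsBlowup τ C)
    {i' : E' ⟶ X'} (hsq : i' ≫ σ = τ ≫ i) {G : X.IdealSheafData} (hG : G ∈ boundaryOf 𝒢) :
    (strictTransformIdeal σ (C.map i) G).comap i' = strictTransformIdeal τ C (G.comap i) := by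
  have hUX : UniformPieces 𝒢 (C.map i) [(C.map i).support] := uniformPieces_map_of_traces i h𝒢 hUE
  have hB : G.comap i ∈ boundaryOf ℬ := comap_mem_boundaryOf i h𝒢 hG
  -- the two one-member identities
  have hX := comap_eq_pow_mul_strictTransformIdeal hsncX hUX (fun _ h => h) hσ hG
  have hE := comap_eq_pow_mul_strictTransformIdeal hsncE hUE (fun _ h => h) hτ hB
  -- the same exponent
  have hal1 : [(G, 1)].map (fun p => (p.1.comap i, p.2)) = [(G.comap i, 1)] := rfl
  have hw : weightOf [(G, 1)] (divisorsOver [(G, 1)] (C.map i) (C.map i).support) =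
      weightOf [(G.comap i, 1)] (divisorsOver [(G.comap i, 1)] C C.support) :=
    weightOf_divisorsOver_map_eq i hal1 C
  -- restrict the X-side identity along `i'`
  have hX' := congrArg (fun K : X'.IdealSheafData => K.comap i') hX
  rw [comap_mul, comap_pow, ← Scheme.IdealSheafData.comap_comp, ← Scheme.IdealSheafData.comap_comp, hsq,
    Scheme.IdealSheafData.comap_comp, Scheme.IdealSheafData.comap_comp, DepthOne.comap_map_centre, hw, hE] at hX'
  exact ((hτ.isEffectiveCartier.pow _).eq_of_mul_eq_mul hX').symm

/-! ## §5 List bookkeeping for the transformed exponent lists -/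

/-- The boundary of a transformed exponent list `L.map (st × id) ++ [(F, e)]` is `(boundaryOf L).map st ++ [F]`. [folklore] -/
theorem boundaryOf_map_strict_append {X X' : Scheme.{u}} (st : X.IdealSheafData → X'.IdealSheafData)
    (L : List (X.IdealSheafData × ℕ)) (F : X'.IdealSheafData) (e : ℕ) :
    boundaryOf (L.map (fun p => (st p.1, p.2)) ++ [(F, e)]) = (boundaryOf L).map st ++ [F] := by
  simp [boundaryOf, List.map_map, Function.comp_def]

/-- Traces of a transformed exponent list: `(L.map (st × id) ++ [(F, e)]).map (·|_{E'}, id) =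
(L.map ((st ·)|_{E'} × id)) ++ [(F|_{E'}, e)]`. [folklore] -/
theorem map_comap_strict_append {X' E' X : Scheme.{u}} (i' : E' ⟶ X') (st : X.IdealSheafData → X'.IdealSheafData)
    (L : List (X.IdealSheafData × ℕ)) (F : X'.IdealSheafData) (e : ℕ) :
    (L.map (fun p => (st p.1, p.2)) ++ [(F, e)]).map (fun p => (p.1.comap i', p.2)) =
      L.map (fun p => ((st p.1).comap i', p.2)) ++ [(F.comap i', e)] := by
  simp [List.map_map, Function.comp_def]

omit [IsClosedImmersion i] in
/-- **Alignment of the transformed lists**: if `𝒢.map (·|_E, id) = ℬ` and every strict transform restricts to the strict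
transform of the trace, then `(𝒢.map (st_X × id)).map (·|_{E'}, id) = ℬ.map (st_E × id)`. [folklore] -/
theorem map_comap_map_strict_eq {X' E' : Scheme.{u}} (i' : E' ⟶ X') (stX : X.IdealSheafData → X'.IdealSheafData)
    (stE : E.IdealSheafData → E'.IdealSheafData) (h𝒢 : 𝒢.map (fun p => (p.1.comap i, p.2)) = ℬ)
    (hst : ∀ G ∈ boundaryOf 𝒢, (stX G).comap i' = stE (G.comap i)) :
    (𝒢.map fun p => (stX p.1, p.2)).map (fun p => (p.1.comap i', p.2)) = ℬ.map fun p => (stE p.1, p.2) := by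
  rw [← h𝒢, List.map_map, List.map_map]
  refine List.map_congr_left fun p hp => ?_
  simp only [Function.comp_apply]
  rw [hst p.1 (fst_mem_boundaryOf hp)]

omit [IsClosedImmersion i] in
/-- The charged members (positive exponent in `𝒩 ++ 𝒢`) restrict to the E-side charged list of `JointStepAtJR`
(`((𝒟 ++ ℬ).filter (0 < ·.2)).map Prod.fst`). [folklore] -/
theorem charged_map_comap {𝒩 : List (X.IdealSheafData × ℕ)} {𝒟 : List (E.IdealSheafData × ℕ)}
    (h𝒢 : 𝒢.map (fun p => (p.1.comap i, p.2)) = ℬ) (h𝒩 : 𝒩.map (fun p => (p.1.comap i, p.2)) = 𝒟) :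
    (charged 𝒢 𝒩).map (fun G => G.comap i) = ((𝒟 ++ ℬ).filter fun p => 0 < p.2).map Prod.fst := by
  rw [← h𝒢, ← h𝒩, ← List.map_append, List.filter_map, charged, boundaryOf, List.map_map, List.map_map]
  rfl

/-- Members of `charged` are members of `boundaryOf (𝒩 ++ 𝒢)` with a positive exponent somewhere. [folklore] -/
theorem mem_charged_iff {X : Scheme.{u}} {𝒢 𝒩 : List (X.IdealSheafData × ℕ)} {G : X.IdealSheafData} :
    G ∈ charged 𝒢 𝒩 ↔ ∃ p ∈ 𝒩 ++ 𝒢, 0 < p.2 ∧ p.1 = G := by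
  simp only [charged, boundaryOf, List.mem_map, List.mem_filter, decide_eq_true_eq]
  exact ⟨fun ⟨p, ⟨hp, hpos⟩, hG⟩ => ⟨p, hp, hpos, hG⟩, fun ⟨p, hp, hpos, hG⟩ => ⟨p, ⟨hp, hpos⟩, hG⟩⟩

end Trace

end DepthGraded

end Summit.ResolutionOfSingularities.ResolutionOfSingularities.Theorems

end
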